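import Literature.AlgebraicGeometry.AbelianSchemes.SerreTwistModuliTupleCM              -- ★ p850045/p850228: the CM tuple head with the coprimality row (d); helpers
import Literature.AlgebraicGeometry.AbelianSchemes.SerreTwistPolarizationDescentRowA    -- ★ p850594 (N2): the exact twisted polarisation from the norm row alone
import HarnessLib

/-!
# The Serre-twisted moduli tuple `(A ⊗ 𝔟, λ′, η′) ∈ 𝓜_{g,δ,n}(S)` from the NORM ROW alone (no `𝔞 + c𝔞 = (1)`)

Road (γ′) «Serre tensor over `X`, classified» of the sheet line `ESHEET` of crux `hLiu418` (cell `hodgecm-mathlib`, F0/P6 «GO 500», E-pen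
2026-09-02 08:39:31Z; prover seat LA7-p01 (g3)).  ★ `exists_serreTwist_cover_rows` ∕ ★ `exists_serreTwist_moduliTuple` ∕ ★
`exists_serreTwist_moduliTuple_of_isCMField′` take a ROSATI PAIR `(a, b)` (resp. the coprimality row `𝔞 ⊔ c𝔞 = ⊤` producing it), used ONLY to
build the exact twisted polarisation.  With ★ (N2) `exists_isExactTwistPol_of_mem_mul` that input is replaced by the norm row
`N ∈ 𝔭 · 𝔮`, `σ(𝔮) ⊆ 𝔭` (CM case: `(ν) = 𝔞 · c𝔞`), so the twisted tuple exists for EVERY junction datum of the sheet law — inert and ramified `𝔞`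
included (the Frobenius-coset data `(𝔞_can, p^f)` of the record).  The proofs are those of the ★ heads with their first line exchanged.

* `exists_serreTwist_cover_rows_of_mem_mul` — (t1)(t1′)(surj)(t2)(t3)(t4)(t5) + Rosati law + uniqueness, from `N ∈ 𝔭·𝔮`;
* `exists_serreTwist_moduliTuple_of_mem_mul` — the tuple `(A ⊗ 𝔟, λ′, η′)` with the moduli fields (`HasType δ` and symplectic liftability
  as presentation-free BINDERS on the exact `λ′`, as in ★ `exists_serreTwist_moduliTuple`);
* `exists_serreTwist_moduliTuple_of_isCMField_rowA` — the CM head: ★ `exists_serreTwist_moduliTuple_of_isCMField′` WITHOUT `hrow_d`.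

References: [Shimura1998] §18.6 Thm. 18.6 (pp. 124–125); [RapoportSmithlingZhang2020Diagonal] §3.2 (p. 11), §4.3 (4.23) (p. 21);
[MumfordAV1970] §7 Thm. 4 (p. 72), §23 Thm. 2 (p. 231); [MumfordFogartyKirwan1994] Ch. 7 §2 Definition 7.2 (p. 129); [Conrad2004GrossZagier] §7 (Thm. 7.5).
-/

set_option autoImplicit false

noncomputable section

universe u

open CategoryTheory CategoryTheory.Limits AlgebraicGeometry
open NumberField
open scoped MonObj NumberField Pointwise

namespace Literature.AlgebraicGeometry.AbelianSchemes

namespace AbelianSchemeOver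

/-! ## §1 The cover rows and the tuple from `N ∈ 𝔭·𝔮` (any `𝒪`, any involution-like `σ`) -/

section General

variable {S : Scheme.{u}} [IsReduced S] [IsLocallyNoetherian S] {A : AbelianSchemeOver S} {O : Type*} [CommRing O] (act : A.RingAction O)
  [IsCommMonObj A.X] {m : ℕ} (E' : Matrix (Fin m) (Fin m) O) (hE' : E' * E' = E') (P : Matrix (Fin m) (Fin 1) O) (Q : Matrix (Fin 1) (Fin m) O)
  {N : ℕ} (D : A.DualPair) (Db : (serreTensor act E' hE').DualPair)
  (hD : Nonempty ((Scheme.Modules.pullback (DualPair.unitHatSlice D)).obj D.P ≅ SheafOfModules.unit _))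
  (hDb : Nonempty ((Scheme.Modules.pullback (DualPair.unitHatSlice Db)).obj Db.P ≅ SheafOfModules.unit _))
  (pol : A.Polarization D) (σ : O → O)

include hD hDb in
/-- **(S1a) FROM THE NORM ROW: THE SERRE-TWISTED FAMILY AND ITS COVER `c : A → A ⊗ 𝔟` WITH ROWS (t1)–(t5)** — ★ `exists_serreTwist_cover_rows` with the
Rosati pair replaced by `N ∈ 𝔭·𝔮`, `σ(𝔮) ⊆ 𝔭` and the `σ`-compatibility of `λ` (★ (N2) `exists_isExactTwistPol_of_mem_mul`).
[cite: RapoportSmithlingZhang2020Diagonal, §3.2 (p. 11) and §4.3 (4.23) (p. 21)] [cite: MumfordAV1970, §7 Thm. 4 (p. 72), §23 Thm. 2 (p. 231)]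
[cite: Conrad2004GrossZagier, §7 (Thm. 7.5)] -/
theorem exists_serreTwist_cover_rows_of_mem_mul [IsDomain O] [CharZero O] (hN : N ≠ 0) (hP : E' * P = P) (hQ : Q * E' = Q)
    (hQP : Q * P = Matrix.scalar (Fin 1) (N : O)) (hPQ : P * Q = Matrix.scalar (Fin m) (N : O) * E')
    {𝔞 : Ideal O} (h𝔞 : Ideal.span (Set.range fun k => P k 0) = 𝔞) (𝔮 : Ideal O) (hσ : ∀ c ∈ 𝔮, σ c ∈ 𝔞) (hN𝔮 : (N : O) ∈ 𝔞 * 𝔮)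
    (hlam : ∀ x, act.i (σ x) ≫ pol.lam = pol.lam ≫ (act.dual D hD).i x)
    {g n : ℕ} (lvl : A.LevelStructure g n) (hcop : Nat.Coprime N n) :
    ∃ (lam' : (serreTensor act E' hE').X ⟶ Db.hat.X) (_ : IsMonHom lam') (lvl' : (serreTensor act E' hE').LevelStructure g n),
      (∀ x ∈ 𝔞, ∃ d : (serreTensor act E' hE').X ⟶ A.X, IsMonHom d ∧
        serreTranslate act E' hE' P ≫ d = act.i x ∧ d ≫ serreTranslate act E' hE' P = (serreAction act E' hE').i x) ∧
      (∀ ⦃T : Over S⦄ (t : T ⟶ A.X), t ≫ serreTranslate act E' hE' P = 1 ↔ ∀ x ∈ 𝔞, t ≫ act.i x = 1) ∧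
      Function.Surjective (serreTranslate act E' hE' P).left.base ∧
      (∀ y : O, (∀ x ∈ 𝔞, y * x ∈ Ideal.span {(N : O)}) → ∃ f : A.X ⟶ (serreTensor act E' hE').X, IsMonHom f ∧
        serreTranslate act E' hE' P ≫ (serreAction act E' hE').i y = f ≫ (serreAction act E' hE').i (N : O)) ∧
      (haveI := isMonHom_serreTranslate act E' hE' P
       serreTranslate act E' hE' P ≫ lam' ≫ DualPair.dualIsogenyOver (serreTranslate act E' hE' P) D Db = pol.lam ≫ D.hat.mulN N) ∧
      (∀ x : O, act.i x ≫ serreTranslate act E' hE' P = serreTranslate act E' hE' P ≫ (serreAction act E' hE').i x) ∧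
      (∀ i, lvl'.σ i = lvl.σ i ≫ serreTranslate act E' hE' P) ∧
      (∀ x : O, (serreAction act E' hE').i (σ x) ≫ lam' = lam' ≫ ((serreAction act E' hE').dual Db hDb).i x) ∧
      (∀ lam'' : (serreTensor act E' hE').X ⟶ Db.hat.X, IsMonHom lam'' →
        (haveI := isMonHom_serreTranslate act E' hE' P
         serreTranslate act E' hE' P ≫ lam'' ≫ DualPair.dualIsogenyOver (serreTranslate act E' hE' P) D Db = pol.lam ≫ D.hat.mulN N) →
        lam'' = lam') := by
  obtain ⟨lam', hmon, hex⟩ :=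
    exists_isExactTwistPol_of_mem_mul act E' hE' P Q D Db hD hDb pol hN hP hQ hQP hPQ h𝔞 𝔮 σ hσ hN𝔮 hlam
  haveI := hmon
  obtain ⟨lvl', hlvl', -⟩ := lvl.existsUnique_serreTwist act E' hE' P Q hN hP hQ hQP hPQ hcop
  have hPmem : ∀ k, P k 0 ∈ 𝔞 := fun k => h𝔞 ▸ Ideal.subset_span ⟨k, rfl⟩
  haveI := surjective_serreTranslate_left act E' hE' P Q hN hP hQ hQP hPQ
  refine ⟨lam', hmon, lvl', ?_, ?_, ?_, ?_, ?_, ?_, hlvl', ?_, ?_⟩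
  · intro x hx
    exact serreTranslate_twoSided_presentation act E' hE' P Q hN hP hQ hQP hPQ h𝔞 hx
  · intro T t
    exact comp_serreTranslate_eq_one_iff_forall_mem act E' hE' P hP h𝔞 t
  · exact (serreTranslate act E' hE' P).left.surjective
  · intro y hy
    exact exists_comp_serreAction_i_eq_of_mul_mem_span act E' hE' P hN hP (fun k => hy _ (hPmem k))
  · exact (isExactTwistPol_iff act E' hE' P D Db pol N lam').mp hex
  · intro x
    exact i_comp_serreTranslate act E' hE' P hP x
  · intro x
    exact serreAction_i_comp_of_isExactTwistPol act E' hE' P Q D Db hD hDb pol σ hN hP hQ hQP hPQ hlam (sq N).symm hex x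
  · intro lam'' hmon'' h''
    haveI := hmon''
    exact IsExactTwistPol.eq act E' hE' P Q D Db hDb pol hN hP hQ hQP hPQ
      ((isExactTwistPol_iff act E' hE' P D Db pol N lam'').mpr h'') hex

include hD hDb in
/-- **THE SERRE-TWISTED MODULI TUPLE FROM THE NORM ROW** — ★ `exists_serreTwist_moduliTuple` with the Rosati pair replaced by `N ∈ 𝔭·𝔮`, `σ(𝔮) ⊆ 𝔭`:
`(A ⊗ 𝔟, λ′, η′)` with relative dimension `g`, type `δ` and a symplectic level-`n` structure (the last two as presentation-free binders on the
exact `λ′`), together with the cover rows (t1)–(t5), the Rosati law of `λ′` and its uniqueness.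
[cite: Shimura1998, §18.6 Thm. 18.6 (pp. 124–125)] [cite: RapoportSmithlingZhang2020Diagonal, §3.2 (p. 11) and §4.3 (4.23) (p. 21)]
[cite: MumfordFogartyKirwan1994, Ch. 7 §2 Definition 7.2 (p. 129)] [cite: MumfordAV1970, §23 Thm. 2 (p. 231)] -/
theorem exists_serreTwist_moduliTuple_of_mem_mul [IsDomain O] [CharZero O] {F : Type u} [Field F] [CharZero F] (f : S ⟶ Spec (.of F))
    (hN : N ≠ 0) (hP : E' * P = P) (hQ : Q * E' = Q)
    (hQP : Q * P = Matrix.scalar (Fin 1) (N : O)) (hPQ : P * Q = Matrix.scalar (Fin m) (N : O) * E')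
    {𝔞 : Ideal O} (h𝔞 : Ideal.span (Set.range fun k => P k 0) = 𝔞) (𝔮 : Ideal O) (hσ : ∀ c ∈ 𝔮, σ c ∈ 𝔞) (hN𝔮 : (N : O) ∈ 𝔞 * 𝔮)
    (hlam : ∀ x, act.i (σ x) ≫ pol.lam = pol.lam ≫ (act.dual D hD).i x)
    {g n : ℕ} {δ : Fin g → ℕ} (hA : A.IsOfRelDim g) (lvl : A.LevelStructure g n) (hcop : Nat.Coprime N n)
    (hT : ∀ polB : (serreTensor act E' hE').Polarization Db, IsExactTwistPol act E' hE' P D Db pol N polB.lam → polB.HasType δ)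
    (hsymp : ∀ (polB : (serreTensor act E' hE').Polarization Db) (lvl' : (serreTensor act E' hE').LevelStructure g n),
      IsExactTwistPol act E' hE' P D Db pol N polB.lam → (∀ i, lvl'.σ i = lvl.σ i ≫ serreTranslate act E' hE' P) →
        lvl'.IsSymplecticLiftable polB δ) :
    ∃ (polB : (serreTensor act E' hE').Polarization Db) (lvl' : (serreTensor act E' hE').LevelStructure g n),
      (serreTensor act E' hE').IsOfRelDim g ∧ polB.HasType δ ∧ lvl'.IsSymplecticLiftable polB δ ∧
      (∀ x ∈ 𝔞, ∃ d : (serreTensor act E' hE').X ⟶ A.X, IsMonHom d ∧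
        serreTranslate act E' hE' P ≫ d = act.i x ∧ d ≫ serreTranslate act E' hE' P = (serreAction act E' hE').i x) ∧
      (∀ ⦃T : Over S⦄ (t : T ⟶ A.X), t ≫ serreTranslate act E' hE' P = 1 ↔ ∀ x ∈ 𝔞, t ≫ act.i x = 1) ∧
      Function.Surjective (serreTranslate act E' hE' P).left.base ∧
      (∀ y : O, (∀ x ∈ 𝔞, y * x ∈ Ideal.span {(N : O)}) → ∃ f : A.X ⟶ (serreTensor act E' hE').X, IsMonHom f ∧
        serreTranslate act E' hE' P ≫ (serreAction act E' hE').i y = f ≫ (serreAction act E' hE').i (N : O)) ∧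
      (haveI := isMonHom_serreTranslate act E' hE' P
       serreTranslate act E' hE' P ≫ polB.lam ≫ DualPair.dualIsogenyOver (serreTranslate act E' hE' P) D Db = pol.lam ≫ D.hat.mulN N) ∧
      (∀ x : O, act.i x ≫ serreTranslate act E' hE' P = serreTranslate act E' hE' P ≫ (serreAction act E' hE').i x) ∧
      (∀ i, lvl'.σ i = lvl.σ i ≫ serreTranslate act E' hE' P) ∧
      (∀ c : Fin g ⊕ Fin g → ZMod n, lvl'.section_ c = lvl.section_ c ≫ serreTranslate act E' hE' P) ∧
      (∀ x : O, (serreAction act E' hE').i (σ x) ≫ polB.lam = polB.lam ≫ ((serreAction act E' hE').dual Db hDb).i x) ∧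
      (∀ lam'' : (serreTensor act E' hE').X ⟶ Db.hat.X, IsMonHom lam'' →
        (haveI := isMonHom_serreTranslate act E' hE' P
         serreTranslate act E' hE' P ≫ lam'' ≫ DualPair.dualIsogenyOver (serreTranslate act E' hE' P) D Db = pol.lam ≫ D.hat.mulN N) →
        lam'' = polB.lam) := by
  obtain ⟨lam', hmon, lvl', ht1, ht1', hsurj, ht2, ht3, ht4, ht5, hros, huniq⟩ :=
    exists_serreTwist_cover_rows_of_mem_mul act E' hE' P Q D Db hD hDb pol σ hN hP hQ hQP hPQ h𝔞 𝔮 hσ hN𝔮 hlam lvl hcop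
  haveI := hmon
  have hex : IsExactTwistPol act E' hE' P D Db pol N lam' := (isExactTwistPol_iff act E' hE' P D Db pol N lam').mpr ht3
  obtain ⟨polB, hpolB⟩ := exists_polarization_lam_eq_of_isExactTwistPol act E' hE' P Q D Db hD hDb pol f hN hP hQ hQP hPQ hex
  have hexB : IsExactTwistPol act E' hE' P D Db pol N polB.lam := by rw [hpolB]; exact hex
  refine ⟨polB, lvl', isOfRelDim_serreTensor act E' hE' P Q hN hP hQ hQP hPQ hA, hT polB hexB, hsymp polB lvl' hexB ht5,
    ht1, ht1', hsurj, ht2, ?_, ht4, ht5, ?_, ?_, ?_⟩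
  · rw [hpolB]; exact ht3
  · intro c
    exact LevelStructure.section_eq_section_comp_serreTranslate act E' hE' P ht5 c
  · intro x
    rw [hpolB]; exact hros x
  · intro lam'' hmon'' h''
    rw [hpolB]; exact huniq lam'' hmon'' h''

end General

/-! ## §2 The CM head without the coprimality row (d) -/

section CM

variable {F : Type} [Field F] [NumberField F] [IsCMField F]
  {S : Scheme.{0}} [IsReduced S] [IsLocallyNoetherian S] {A : AbelianSchemeOver S} (act : A.RingAction (𝓞 F)) [IsCommMonObj A.X]
  (D : A.DualPair) (hD : Nonempty ((Scheme.Modules.pullback (DualPair.unitHatSlice D)).obj D.P ≅ SheafOfModules.unit _))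
  (pol : A.Polarization D)

include hD in
/-- **THE SERRE-TWISTED MODULI TUPLE OF A CM FAMILY FROM THE NORM ROW `(ν) = 𝔞 · c𝔞` ALONE** (road (γ′) of the sheet law): ★
`exists_serreTwist_moduliTuple_of_isCMField′` WITHOUT `hrow_d : 𝔞 ⊔ c𝔞 = ⊤` — for EVERY nonzero `𝔞` with `(ν) = 𝔞 · c𝔞` and `(ν, n) = 1` (inert and
ramified `𝔞` included), given the field Rosati law, a level-`n` structure, the presentation-indexed dual pair `hdual` (★ `exists_serreTensor_dualPair_unit`)
and the presentation-free binders `hT` (type `δ` of the exact `λ′`) and `hsymp` (symplectic liftability): a presentation `(E′, P, Q, ν)` of `𝔞⁻¹` and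
the tuple `(A ⊗ 𝔟, λ′, η′) ∈ 𝓜_{g,δ,n}(S)` with the cover rows (t1)(t1′)(t2 through `c•𝔞`)(t3)(t4)(t5), the Rosati law of `λ′` and its uniqueness.
[cite: Shimura1998, §18.6 Thm. 18.6 (pp. 124–125)] [cite: RapoportSmithlingZhang2020Diagonal, §3.2 (p. 11) and §4.3 (4.23) (p. 21)]
[cite: MumfordFogartyKirwan1994, Ch. 7 §2 Definition 7.2 (p. 129)] [cite: MumfordAV1970, §23 Thm. 2 (p. 231)] -/
theorem exists_serreTwist_moduliTuple_of_isCMField_rowA {Fi : Type} [Field Fi] [CharZero Fi] (f : S ⟶ Spec (.of Fi))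
    (rosati : ∀ (b b' : 𝓞 F), (b' : F) = (IsCMField.complexConj F) (b : F) →
      haveI := act.isMonHom b
      act.i b' ≫ pol.lam = pol.lam ≫ DualPair.dualIsogenyOver (act.i b) D D)
    {g n : ℕ} {δ : Fin g → ℕ} (hA : A.IsOfRelDim g) (lvl : A.LevelStructure g n)
    {𝔞 : Ideal (𝓞 F)} (h𝔞 : 𝔞 ≠ ⊥) {ν : ℕ} (hν : ν ≠ 0)
    (hrow_a : Ideal.span {((ν : ℕ) : 𝓞 F)} = 𝔞 * (IsCMField.complexConj F) • 𝔞) (hcop : Nat.Coprime ν n)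
    (hdual : ∀ {m : ℕ} (E' : Matrix (Fin m) (Fin m) (𝓞 F)) (hE' : E' * E' = E') (P : Matrix (Fin m) (Fin 1) (𝓞 F)) (Q : Matrix (Fin 1) (Fin m) (𝓞 F)),
      E' * P = P → Q * E' = Q → Q * P = Matrix.scalar (Fin 1) ((ν : ℕ) : 𝓞 F) → P * Q = Matrix.scalar (Fin m) ((ν : ℕ) : 𝓞 F) * E' →
      Ideal.span (Set.range fun k => P k 0) = 𝔞 →
      ∃ Db : (serreTensor act E' hE').DualPair,
        Nonempty ((Scheme.Modules.pullback (DualPair.unitHatSlice Db)).obj Db.P ≅ SheafOfModules.unit _))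
    (hT : ∀ {m : ℕ} (E' : Matrix (Fin m) (Fin m) (𝓞 F)) (hE' : E' * E' = E') (P : Matrix (Fin m) (Fin 1) (𝓞 F)) (Q : Matrix (Fin 1) (Fin m) (𝓞 F)),
      E' * P = P → Q * E' = Q → Q * P = Matrix.scalar (Fin 1) ((ν : ℕ) : 𝓞 F) → P * Q = Matrix.scalar (Fin m) ((ν : ℕ) : 𝓞 F) * E' →
      Ideal.span (Set.range fun k => P k 0) = 𝔞 →
      ∀ (Db : (serreTensor act E' hE').DualPair)
        (_ : Nonempty ((Scheme.Modules.pullback (DualPair.unitHatSlice Db)).obj Db.P ≅ SheafOfModules.unit _))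
        (polB : (serreTensor act E' hE').Polarization Db), IsExactTwistPol act E' hE' P D Db pol ν polB.lam → polB.HasType δ)
    (hsymp : ∀ {m : ℕ} (E' : Matrix (Fin m) (Fin m) (𝓞 F)) (hE' : E' * E' = E') (P : Matrix (Fin m) (Fin 1) (𝓞 F)) (Q : Matrix (Fin 1) (Fin m) (𝓞 F)),
      E' * P = P → Q * E' = Q → Q * P = Matrix.scalar (Fin 1) ((ν : ℕ) : 𝓞 F) → P * Q = Matrix.scalar (Fin m) ((ν : ℕ) : 𝓞 F) * E' →
      Ideal.span (Set.range fun k => P k 0) = 𝔞 →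
      ∀ (Db : (serreTensor act E' hE').DualPair)
        (_ : Nonempty ((Scheme.Modules.pullback (DualPair.unitHatSlice Db)).obj Db.P ≅ SheafOfModules.unit _))
        (polB : (serreTensor act E' hE').Polarization Db) (lvl' : (serreTensor act E' hE').LevelStructure g n),
        IsExactTwistPol act E' hE' P D Db pol ν polB.lam → (∀ i, lvl'.σ i = lvl.σ i ≫ serreTranslate act E' hE' P) →
          lvl'.IsSymplecticLiftable polB δ) :
    ∃ (m : ℕ) (E' : Matrix (Fin m) (Fin m) (𝓞 F)) (hE' : E' * E' = E') (P : Matrix (Fin m) (Fin 1) (𝓞 F)) (Q : Matrix (Fin 1) (Fin m) (𝓞 F))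
      (Db : (serreTensor act E' hE').DualPair)
      (hDb : Nonempty ((Scheme.Modules.pullback (DualPair.unitHatSlice Db)).obj Db.P ≅ SheafOfModules.unit _))
      (polB : (serreTensor act E' hE').Polarization Db) (lvl' : (serreTensor act E' hE').LevelStructure g n),
      E' * P = P ∧ Q * E' = Q ∧ Q * P = Matrix.scalar (Fin 1) ((ν : ℕ) : 𝓞 F) ∧ P * Q = Matrix.scalar (Fin m) ((ν : ℕ) : 𝓞 F) * E' ∧
      Ideal.span (Set.range fun k => P k 0) = 𝔞 ∧
      (serreTensor act E' hE').IsOfRelDim g ∧ polB.HasType δ ∧ lvl'.IsSymplecticLiftable polB δ ∧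
      (∀ x ∈ 𝔞, ∃ d : (serreTensor act E' hE').X ⟶ A.X, IsMonHom d ∧
        serreTranslate act E' hE' P ≫ d = act.i x ∧ d ≫ serreTranslate act E' hE' P = (serreAction act E' hE').i x) ∧
      (∀ ⦃T : Over S⦄ (t : T ⟶ A.X), t ≫ serreTranslate act E' hE' P = 1 ↔ ∀ x ∈ 𝔞, t ≫ act.i x = 1) ∧
      Function.Surjective (serreTranslate act E' hE' P).left.base ∧
      (∀ y ∈ (IsCMField.complexConj F) • 𝔞, ∃ f : A.X ⟶ (serreTensor act E' hE').X, IsMonHom f ∧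
        serreTranslate act E' hE' P ≫ (serreAction act E' hE').i y = f ≫ (serreAction act E' hE').i ((ν : ℕ) : 𝓞 F)) ∧
      (haveI := isMonHom_serreTranslate act E' hE' P
       serreTranslate act E' hE' P ≫ polB.lam ≫ DualPair.dualIsogenyOver (serreTranslate act E' hE' P) D Db = pol.lam ≫ D.hat.mulN ν) ∧
      (∀ x : 𝓞 F, act.i x ≫ serreTranslate act E' hE' P = serreTranslate act E' hE' P ≫ (serreAction act E' hE').i x) ∧
      (∀ i, lvl'.σ i = lvl.σ i ≫ serreTranslate act E' hE' P) ∧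
      (∀ c : Fin g ⊕ Fin g → ZMod n, lvl'.section_ c = lvl.section_ c ≫ serreTranslate act E' hE' P) ∧
      (∀ x : 𝓞 F, (serreAction act E' hE').i ((IsCMField.complexConj F) • x) ≫ polB.lam =
        polB.lam ≫ ((serreAction act E' hE').dual Db hDb).i x) ∧
      (∀ lam'' : (serreTensor act E' hE').X ⟶ Db.hat.X, IsMonHom lam'' →
        (haveI := isMonHom_serreTranslate act E' hE' P
         serreTranslate act E' hE' P ≫ lam'' ≫ DualPair.dualIsogenyOver (serreTranslate act E' hE' P) D Db = pol.lam ≫ D.hat.mulN ν) →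
        lam'' = polB.lam) := by
  -- the presentation of `𝔞⁻¹` with scalar `ν ∈ 𝔞`
  have hνmem : ((ν : ℕ) : 𝓞 F) ∈ 𝔞 := natCast_mem_of_span_eq_mul hrow_a
  obtain ⟨m, E', hE', P, Q, hP, hQ, hQP, hPQ, hspan, -, -⟩ :=
    Literature.NumberTheory.NumberFields.SerrePresentation.exists_serrePresentation_of_ideal_of_natCast_mem 𝔞 h𝔞 hνmem
  -- the dual pair of the twist
  obtain ⟨Db, hDb⟩ := hdual E' hE' P Q hP hQ hQP hPQ hspan
  -- the Rosati law from the field, and the norm row as `ν ∈ 𝔞 · c𝔞`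
  have hlam : ∀ x : 𝓞 F, act.i ((IsCMField.complexConj F) • x) ≫ pol.lam = pol.lam ≫ (act.dual D hD).i x :=
    fun x => rosati x _ rfl
  have hN𝔮 : ((ν : ℕ) : 𝓞 F) ∈ 𝔞 * (IsCMField.complexConj F) • 𝔞 := hrow_a ▸ Ideal.subset_span (Set.mem_singleton _)
  -- the capstone, from the norm row
  obtain ⟨polB, lvl', hrel, hTB, hs, ht1, ht1', hsurj, ht2, ht3, ht4, ht5, ht5', hros, huniq⟩ :=
    exists_serreTwist_moduliTuple_of_mem_mul act E' hE' P Q D Db hD hDb pol (fun x => (IsCMField.complexConj F) • x) f hν hP hQ hQP hPQ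
      hspan ((IsCMField.complexConj F) • 𝔞) (fun _ hc => complexConj_smul_mem_of_mem_complexConj_smul 𝔞 hc) hN𝔮
      hlam hA lvl hcop (fun polB hex => hT E' hE' P Q hP hQ hQP hPQ hspan Db hDb polB hex)
      (fun polB lvl' hex h5 => hsymp E' hE' P Q hP hQ hQP hPQ hspan Db hDb polB lvl' hex h5)
  refine ⟨m, E', hE', P, Q, Db, hDb, polB, lvl', hP, hQ, hQP, hPQ, hspan, hrel, hTB, hs, ht1, ht1', hsurj, ?_, ht3, ht4, ht5, ht5', hros, huniq⟩
  -- (t2): `y ∈ c•𝔞` gives `y·x ∈ (ν)` for all `x ∈ 𝔞` by the norm row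
  intro y hy
  exact ht2 y (fun x hx => mul_mem_span_natCast_of_mem_of_span_eq_mul hrow_a hy x hx)

end CM

end AbelianSchemeOver

end Literature.AlgebraicGeometry.AbelianSchemes

end
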